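import Summits.HubbardSuperconductivity.HubbardSuperconductivity.Theorems.DeformationLadderLowEnergyRigidityTelescopeRigidityCells
import Summits.HubbardSuperconductivity.HubbardSuperconductivity.Theorems.DeformationLadderLowEnergyRigidityTelescopeRigidity
import Summits.HubbardSuperconductivity.HubbardSuperconductivity.Theorems.TwistGapTgCruxGlue

/-!
# Telescope rigidity, part 9a: one cell bond in Fourier variables (kinematics for the converse)

Route `DeformationLadder`, crux `LowEnergyRigidity` (item stmt-HubbardSuperconductivity-1892), line
`Sketch` (poincare-telescope). Support file (`--supports stmt-HubbardSuperconductivity-1892`).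

The CONVERSE of part 6: at a point `(U, δ)`, the body of `TwistGap.TgPairMomentumRigidity` (pair
weight at nonzero infrared momenta costs total energy) implies top-scale cell rigidity (for every
fixed cell count `k ≥ 4` and `ε > 0` some `J(k, ε) > 0` with
`J((k/L)⁴ Re⟨𝒟_k⟩ − ε) ≤ Re⟨H_L⟩ − E₀` eventually) — `topScaleRigidity_of_pairMomentumRigidity`.
With part 6 this makes TwistGap's rigidity crux at a point EQUIVALENT to macroscopic cell rigidity in
the telescope's language (`topScaleRigidity_iff_pairMomentumRigidity`).

Kinematics (`rigc_dirichlet_density_le`, every unit vector `φ`, `K ≥ 1`, `L ≥ k`):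
`(k/L)⁴ Re⟨φ, 𝒟_k φ⟩ ≤ 96 p₀² k⁴/L² + 384 k² (2K+1)² S'_K(φ) + 48 p₀² k⁵/K`,
`S'_K(φ) = Σ_{0 ≠ q ∈ W_K} L⁻⁴ ‖Δ_d(q) φ‖²`: expand each cell-bond difference
`(Δ_b − Δ_{b'}) φ = L⁻² Σ_q (ĝ_b − ĝ_{b'})(q) Δ_d(q) φ` (Fourier inversion, part 7) and split the
momenta into `q = 0` (coefficient `|b| − |b'| = O(L/k)` by the row sizes, part 8), the window
(`|ĝ| ≤ |b| + |b'|`, Cauchy–Schwarz against `S'`) and the tail (Cauchy–Schwarz against the sum rule,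
with the Dirichlet-kernel tail estimate of part 8). Then `K`, `σ` and `L₀` are chosen against `ε`.
CONDITIONAL in use (the hypothesis is conjecture-grade); the kinematic inequality is unconditional.
No definitions. [folklore]
-/

noncomputable section

namespace Summit.HubbardSuperconductivity.HubbardSuperconductivity.Theorems.LowEnergyRigidity.Telescope

set_option linter.dupNamespace false -- summit = problem name (single-conjunct summit), D-0017

open Matrix Literature.MathematicalPhysics.QuantumLattice Literature.Probability.LatticeModels
open scoped ComplexConjugate ComplexOrder Matrix.Norms.L2Operator
open Summit.HubbardSuperconductivity.HubbardSuperconductivity.Theses.DeformationLadder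
open Summit.HubbardSuperconductivity.HubbardSuperconductivity.Theorems.TwistGap (windowSum_eq_zero_add)
open Summit.HubbardSuperconductivity.HubbardSuperconductivity.Theorems (minEnergyOn_le_re_rayleigh)

/-! ### A cell bond as a coefficient family, and its transform -/

/-- The cell pair field applied to a vector: `Δ_b φ = Σ_x [cellOf x = b] P_x φ`. [folklore] -/
theorem rigc_cellPair_mulVec (L : ℕ) [NeZero L] (k : ℕ) [NeZero k] (b : TorusSite 2 k)
    (φ : Fock (Orb (FermionTorus 2 L))) :
    cellPair L k b *ᵥ φ = ∑ x : TorusSite 2 L,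
      (if cellOf L k x = b then (1 : ℂ) else 0) • (localPair dWaveFormFactor L x *ᵥ φ) := by
  classical
  unfold cellPair
  rw [Matrix.sum_mulVec, Finset.sum_filter]
  refine Finset.sum_congr rfl fun x _ => ?_
  split_ifs <;> simp

/-- A cell-bond difference applied to a vector as a coefficient family:
`(Δ_b − Δ_{b'}) φ = Σ_x g(x) P_x φ`, `g = [· ∈ b] − [· ∈ b']`. [folklore] -/
theorem rigc_bond_mulVec (L : ℕ) [NeZero L] (k : ℕ) [NeZero k] (b b' : TorusSite 2 k)
    (φ : Fock (Orb (FermionTorus 2 L))) :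
    (cellPair L k b - cellPair L k b') *ᵥ φ = ∑ x : TorusSite 2 L,
      ((if cellOf L k x = b then (1 : ℂ) else 0) - (if cellOf L k x = b' then (1 : ℂ) else 0)) •
        (localPair dWaveFormFactor L x *ᵥ φ) := by
  rw [Matrix.sub_mulVec, rigc_cellPair_mulVec, rigc_cellPair_mulVec, ← Finset.sum_sub_distrib]
  refine Finset.sum_congr rfl fun x _ => ?_
  rw [sub_smul]

/-- The transform of the bond coefficients is the difference of the two cell transforms. [folklore] -/
theorem rigc_bondTransform (L : ℕ) [NeZero L] (k : ℕ) [NeZero k] (b b' : TorusSite 2 k) (q : TorusSite 2 L) :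
    ∑ x : TorusSite 2 L, ((if cellOf L k x = b then (1 : ℂ) else 0) - (if cellOf L k x = b' then (1 : ℂ) else 0)) *
        torusChar q x =
      (∑ x ∈ Finset.univ.filter (fun x : TorusSite 2 L => cellOf L k x = b), torusChar q x) -
        ∑ x ∈ Finset.univ.filter (fun x : TorusSite 2 L => cellOf L k x = b'), torusChar q x := by
  classical
  rw [Finset.sum_filter, Finset.sum_filter, ← Finset.sum_sub_distrib]
  refine Finset.sum_congr rfl fun x _ => ?_
  split_ifs <;> simp

/-! ### Cell sizes along a bond -/

/-- Row sizes differ by less than `2` and are less than `L/k + 1`; hence for neighbouring cells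
`b' = b + eᵢ`, `| |b| − |b'| | ≤ 2 (L/k + 1)`. [folklore] -/
theorem rigc_card_cell_sub_le (L : ℕ) [NeZero L] (k : ℕ) [NeZero k] (b : TorusSite 2 k) (i : Fin 2) :
    |((Finset.univ.filter (fun x : TorusSite 2 L => cellOf L k x = b)).card : ℝ) -
        ((Finset.univ.filter (fun x : TorusSite 2 L => cellOf L k x = b + Pi.single i 1)).card : ℝ)| ≤
      2 * ((L : ℝ) / k + 1) := by
  classical
  have hk : 0 < k := Nat.pos_of_ne_zero (NeZero.ne k)
  have hL : (0 : ℝ) < L := Nat.cast_pos.mpr (Nat.pos_of_ne_zero (NeZero.ne L))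
  have hkr : (0 : ℝ) < k := by exact_mod_cast hk
  -- row sizes
  set n : ZMod k → ℝ := fun j => ((Finset.univ.filter (fun x : ZMod L => x.val * k / L = j.val)).card : ℝ) with hn
  have hnb : ∀ j : ZMod k, (L : ℝ) / k - 1 < n j ∧ n j < (L : ℝ) / k + 1 := fun j =>
    rigc_row_card_bounds L hk (ZMod.val_lt j)
  have hn0 : ∀ j : ZMod k, 0 ≤ n j := fun j => by rw [hn]; positivity
  have hcard : ∀ c : TorusSite 2 k,
      ((Finset.univ.filter (fun x : TorusSite 2 L => cellOf L k x = c)).card : ℝ) = n (c 0) * n (c 1) := by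
    intro c
    rw [rigc_cell_card, Fin.prod_univ_two]
    push_cast
    rfl
  rw [hcard, hcard]
  -- the two cells share the row in the coordinate `≠ i`
  have hdiff : ∀ j j' : ZMod k, |n j - n j'| ≤ 2 := fun j j' => by
    have h1 := hnb j; have h2 := hnb j'
    rw [abs_le]; constructor <;> linarith
  have hle : ∀ j : ZMod k, n j ≤ (L : ℝ) / k + 1 := fun j => (hnb j).2.le
  revert i
  rw [Fin.forall_fin_two]
  constructor
  · have h0 : ((b + Pi.single (0 : Fin 2) (1 : ZMod k) : TorusSite 2 k) 1) = b 1 := by simp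
    have h0' : ((b + Pi.single (0 : Fin 2) (1 : ZMod k) : TorusSite 2 k) 0) = b 0 + 1 := by simp
    rw [h0, h0', ← sub_mul, abs_mul, abs_of_nonneg (hn0 _)]
    exact mul_le_mul (hdiff _ _) (hle _) (hn0 _) zero_le_two
  · have h1 : ((b + Pi.single (1 : Fin 2) (1 : ZMod k) : TorusSite 2 k) 0) = b 0 := by simp
    have h1' : ((b + Pi.single (1 : Fin 2) (1 : ZMod k) : TorusSite 2 k) 1) = b 1 + 1 := by simp
    rw [h1, h1', ← mul_sub, abs_mul, abs_of_nonneg (hn0 _)]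
    have := mul_le_mul (hle (b 0)) (hdiff (b 1) (b 1 + 1)) (abs_nonneg _) (by positivity)
    linarith

/-- A cell has at most `(L/k + 1)²` sites. [folklore] -/
theorem rigc_card_cell_le (L : ℕ) [NeZero L] (k : ℕ) [NeZero k] (b : TorusSite 2 k) :
    ((Finset.univ.filter (fun x : TorusSite 2 L => cellOf L k x = b)).card : ℝ) ≤ ((L : ℝ) / k + 1) ^ 2 := by
  classical
  have hk : 0 < k := Nat.pos_of_ne_zero (NeZero.ne k)
  rw [rigc_cell_card, Fin.prod_univ_two]
  push_cast
  have h0 := (rigc_row_card_bounds L hk (ZMod.val_lt (b 0))).2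
  have h1 := (rigc_row_card_bounds L hk (ZMod.val_lt (b 1))).2
  have hp0 : (0 : ℝ) ≤ ((Finset.univ.filter (fun x : ZMod L => x.val * k / L = (b 0).val)).card : ℝ) := by positivity
  have hp1 : (0 : ℝ) ≤ ((Finset.univ.filter (fun x : ZMod L => x.val * k / L = (b 1).val)).card : ℝ) := by positivity
  nlinarith

/-! ### The one-bond estimate -/

/-- **One cell bond in Fourier variables.** For `K ≥ 1`, a cell `b`, a direction `i` and a unit vector
`φ`, with `u_y = P_y φ`, `w_q = Σ_y conj χ_q(y) u_y`, `W'_K` the nonzero window momenta and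
`p₀ = 2 Σ_e |d(e)/√2|`:
`‖(Δ_b − Δ_{b+eᵢ}) φ‖² ≤ 12 ( (L/k+1)² p₀² + (L/k+1)⁴ (2K+1)² Σ_{q ∈ W'} ‖w_q‖²/L⁴ + L³ (L/k+1) p₀²/K )`.
[folklore] -/
theorem rigc_bond_sq_le (L : ℕ) [NeZero L] (k : ℕ) [NeZero k] {K : ℕ} (hK : 1 ≤ K)
    (b : TorusSite 2 k) (i : Fin 2) {φ : Fock (Orb (FermionTorus 2 L))} (hφ : star φ ⬝ᵥ φ = 1) :
    eucNorm ((cellPair L k b - cellPair L k (b + Pi.single i 1)) *ᵥ φ) ^ 2 ≤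
      12 * (((L : ℝ) / k + 1) ^ 2 * (2 * ∑ e ∈ insert (0 : Site 2) unitSteps, |dWaveFormFactor e / Real.sqrt 2|) ^ 2 +
        ((L : ℝ) / k + 1) ^ 4 * (((2 * K + 1) ^ 2 : ℕ) : ℝ) *
          ((∑ q ∈ Finset.univ.filter (fun q : TorusSite 2 L => q ≠ 0 ∧ ∀ j : Fin 2, min (q j).val (L - (q j).val) ≤ K),
            eucNorm (∑ y : TorusSite 2 L, conj (torusChar q y) • (localPair dWaveFormFactor L y *ᵥ φ)) ^ 2) / (L : ℝ) ^ 4) +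
        (L : ℝ) ^ 3 * ((L : ℝ) / k + 1) * (2 * ∑ e ∈ insert (0 : Site 2) unitSteps, |dWaveFormFactor e / Real.sqrt 2|) ^ 2 / K) := by
  classical
  have hk : 0 < k := Nat.pos_of_ne_zero (NeZero.ne k)
  have hL : (0 : ℝ) < L := Nat.cast_pos.mpr (Nat.pos_of_ne_zero (NeZero.ne L))
  have hkr : (0 : ℝ) < k := by exact_mod_cast hk
  have hKr : (0 : ℝ) < K := by exact_mod_cast hK
  set p₀ : ℝ := 2 * ∑ e ∈ insert (0 : Site 2) unitSteps, |dWaveFormFactor e / Real.sqrt 2| with hp₀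
  have hp₀0 : 0 ≤ p₀ := by rw [hp₀]; exact mul_nonneg zero_le_two (Finset.sum_nonneg fun _ _ => abs_nonneg _)
  set ℓ : ℝ := (L : ℝ) / k + 1 with hℓ
  have hℓ0 : 0 ≤ ℓ := by positivity
  set M : ℝ := (((2 * K + 1) ^ 2 : ℕ) : ℝ) with hM
  set b' : TorusSite 2 k := b + Pi.single i 1 with hb'
  -- the families
  set u : TorusSite 2 L → Fock (Orb (FermionTorus 2 L)) := fun y => localPair dWaveFormFactor L y *ᵥ φ with hu
  set w : TorusSite 2 L → Fock (Orb (FermionTorus 2 L)) := fun q => ∑ y, conj (torusChar q y) • u y with hw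
  set g : TorusSite 2 L → ℂ := fun x =>
    (if cellOf L k x = b then (1 : ℂ) else 0) - (if cellOf L k x = b' then (1 : ℂ) else 0) with hg
  set gh : TorusSite 2 L → ℂ := fun q => ∑ x, g x * torusChar q x with hgh
  set Cb := Finset.univ.filter (fun x : TorusSite 2 L => cellOf L k x = b) with hCb
  set Cb' := Finset.univ.filter (fun x : TorusSite 2 L => cellOf L k x = b') with hCb'
  set W' := Finset.univ.filter (fun q : TorusSite 2 L => q ≠ 0 ∧ ∀ j : Fin 2, min (q j).val (L - (q j).val) ≤ K) with hW'
  set T := Finset.univ.filter (fun q : TorusSite 2 L => ¬ ∀ j : Fin 2, min (q j).val (L - (q j).val) ≤ K) with hT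
  -- a priori bounds on `u`, `w`
  have hu1 : ∀ y, eucNorm (u y) ≤ p₀ := fun y => by
    refine (eucNorm_mulVec_le _ _).trans ?_
    rw [eucNorm_eq_one hφ, mul_one]
    exact norm_localPair_le dWaveFormFactor L y
  have hw0 : eucNorm (w 0) ≤ (L : ℝ) ^ 2 * p₀ := by
    have h1 : w 0 = ∑ y, u y := by
      rw [hw]; simp only
      refine Finset.sum_congr rfl fun y _ => ?_
      rw [torusChar_comm]; simp [torusChar]
    rw [h1]
    refine (rig_eucNorm_sum_le _ _).trans ?_
    calc ∑ y : TorusSite 2 L, eucNorm (u y) ≤ ∑ _y : TorusSite 2 L, p₀ := Finset.sum_le_sum fun y _ => hu1 y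
      _ = (L : ℝ) ^ 2 * p₀ := by
          rw [Finset.sum_const, Finset.card_univ, BondMode.card_torusSite_two, nsmul_eq_mul]; push_cast; ring
  have hwsum : ∑ q : TorusSite 2 L, eucNorm (w q) ^ 2 ≤ (L : ℝ) ^ 2 * ((L : ℝ) ^ 2 * p₀ ^ 2) := by
    rw [hw]
    simp only
    rw [rigc_sum_eucNorm_mode_sq]
    refine mul_le_mul_of_nonneg_left ?_ (by positivity)
    have := rig_sum_eucNorm_localPair_sq_le L hφ
    rw [← hp₀] at this
    exact this
  -- bounds on the transform `gh`
  have hgh_eq : ∀ q, gh q = (∑ x ∈ Cb, torusChar q x) - ∑ x ∈ Cb', torusChar q x := fun q =>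
    rigc_bondTransform L k b b' q
  have hcardb : (Cb.card : ℝ) ≤ ℓ ^ 2 := rigc_card_cell_le L k b
  have hcardb' : (Cb'.card : ℝ) ≤ ℓ ^ 2 := rigc_card_cell_le L k b'
  have hgh0 : ‖gh 0‖ ≤ 2 * ℓ := by
    rw [hgh_eq, rigc_cellTransform_zero, rigc_cellTransform_zero, ← Complex.ofReal_natCast, ← Complex.ofReal_natCast,
      ← Complex.ofReal_sub, Complex.norm_real, Real.norm_eq_abs]
    exact rigc_card_cell_sub_le L k b i
  have hghW : ∀ q, ‖gh q‖ ≤ 2 * ℓ ^ 2 := fun q => by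
    rw [hgh_eq]
    refine (norm_sub_le _ _).trans ?_
    have h1 := rigc_norm_cellTransform_le L k b q
    have h2 := rigc_norm_cellTransform_le L k b' q
    linarith
  have hghT : ∑ q ∈ T, ‖gh q‖ ^ 2 ≤ 4 * (L : ℝ) ^ 3 * ℓ / K := by
    -- `T ⊆ F₀ ∪ F₁`
    set F0 := Finset.univ.filter (fun q : TorusSite 2 L => K < min (q 0).val (L - (q 0).val)) with hF0
    set F1 := Finset.univ.filter (fun q : TorusSite 2 L => K < min (q 1).val (L - (q 1).val)) with hF1
    have hsub : T ⊆ F0 ∪ F1 := by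
      intro q hq
      rw [hT, Finset.mem_filter] at hq
      rw [Finset.mem_union, hF0, hF1, Finset.mem_filter, Finset.mem_filter]
      by_contra hcon
      push Not at hcon
      apply hq.2
      intro j
      fin_cases j
      · exact hcon.1 (Finset.mem_univ _)
      · exact hcon.2 (Finset.mem_univ _)
    have hcell : ∀ c : TorusSite 2 k, ∑ q ∈ F0 ∪ F1, ‖∑ x ∈ Finset.univ.filter (fun x : TorusSite 2 L => cellOf L k x = c), torusChar q x‖ ^ 2 ≤
        2 * ((L : ℝ) ^ 2 / (2 * K) * ((L : ℝ) * ℓ)) := by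
      intro c
      have hu := Finset.sum_union_inter (s₁ := F0) (s₂ := F1)
        (f := fun q => ‖∑ x ∈ Finset.univ.filter (fun x : TorusSite 2 L => cellOf L k x = c), torusChar q x‖ ^ 2)
      have hi : 0 ≤ ∑ q ∈ F0 ∩ F1, ‖∑ x ∈ Finset.univ.filter (fun x : TorusSite 2 L => cellOf L k x = c), torusChar q x‖ ^ 2 :=
        Finset.sum_nonneg fun _ _ => by positivity
      have h0 := rigc_cellTransform_tail_le_zero L k c hK
      have h1 := rigc_cellTransform_tail_le_one L k c hK
      rw [hℓ]
      linarith
    have hpt : ∀ q, ‖gh q‖ ^ 2 ≤ 2 * ‖∑ x ∈ Cb, torusChar q x‖ ^ 2 + 2 * ‖∑ x ∈ Cb', torusChar q x‖ ^ 2 := fun q => by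
      rw [hgh_eq]
      have hsub := norm_sub_le (∑ x ∈ Cb, torusChar q x) (∑ x ∈ Cb', torusChar q x)
      have hn0 := norm_nonneg ((∑ x ∈ Cb, torusChar q x) - ∑ x ∈ Cb', torusChar q x)
      nlinarith [sq_nonneg (‖∑ x ∈ Cb, torusChar q x‖ - ‖∑ x ∈ Cb', torusChar q x‖),
        norm_nonneg (∑ x ∈ Cb, torusChar q x), norm_nonneg (∑ x ∈ Cb', torusChar q x)]
    calc ∑ q ∈ T, ‖gh q‖ ^ 2 ≤ ∑ q ∈ F0 ∪ F1, ‖gh q‖ ^ 2 :=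
          Finset.sum_le_sum_of_subset_of_nonneg hsub (fun q _ _ => by positivity)
      _ ≤ ∑ q ∈ F0 ∪ F1, (2 * ‖∑ x ∈ Cb, torusChar q x‖ ^ 2 + 2 * ‖∑ x ∈ Cb', torusChar q x‖ ^ 2) :=
          Finset.sum_le_sum fun q _ => hpt q
      _ = 2 * ∑ q ∈ F0 ∪ F1, ‖∑ x ∈ Cb, torusChar q x‖ ^ 2 + 2 * ∑ q ∈ F0 ∪ F1, ‖∑ x ∈ Cb', torusChar q x‖ ^ 2 := by
          rw [Finset.sum_add_distrib, Finset.mul_sum, Finset.mul_sum]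
      _ ≤ 2 * (2 * ((L : ℝ) ^ 2 / (2 * K) * ((L : ℝ) * ℓ))) + 2 * (2 * ((L : ℝ) ^ 2 / (2 * K) * ((L : ℝ) * ℓ))) := by
          have h1 := hcell b; have h2 := hcell b'; rw [← hCb] at h1; rw [← hCb'] at h2; linarith
      _ = 4 * (L : ℝ) ^ 3 * ℓ / K := by field_simp; ring
  -- the Fourier representation of the bond and its norm
  have hG : (cellPair L k b - cellPair L k b') *ᵥ φ = ((L : ℂ) ^ 2)⁻¹ • ∑ q, gh q • w q := by
    rw [rigc_bond_mulVec, rigc_fourier_inversion]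
  have hnormG : eucNorm ((cellPair L k b - cellPair L k b') *ᵥ φ) ≤ ((L : ℝ) ^ 2)⁻¹ * ∑ q, ‖gh q‖ * eucNorm (w q) := by
    rw [hG, eucNorm_smul, norm_inv, norm_pow, Complex.norm_natCast]
    exact mul_le_mul_of_nonneg_left (rig_eucNorm_sum_smul_le _ _ _) (by positivity)
  -- split the momentum sum: window (`0` + `W'`) and tail
  set f : TorusSite 2 L → ℝ := fun q => ‖gh q‖ * eucNorm (w q) with hf
  have hf0 : ∀ q, 0 ≤ f q := fun q => mul_nonneg (norm_nonneg _) (eucNorm_nonneg _)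
  have hsplit : ∑ q, f q = f 0 + ∑ q ∈ W', f q + ∑ q ∈ T, f q := by
    rw [← Finset.sum_filter_add_sum_filter_not Finset.univ (fun q : TorusSite 2 L => ∀ j : Fin 2, min (q j).val (L - (q j).val) ≤ K) f,
      windowSum_eq_zero_add L K f]
  -- the three pieces
  have hA0 : f 0 ≤ 2 * ℓ * ((L : ℝ) ^ 2 * p₀) := by
    rw [hf]; exact mul_le_mul (hgh0) hw0 (eucNorm_nonneg _) (by positivity)
  have hAW : (∑ q ∈ W', f q) ^ 2 ≤ 4 * ℓ ^ 4 * M * ∑ q ∈ W', eucNorm (w q) ^ 2 := by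
    have h1 : ∑ q ∈ W', f q ≤ 2 * ℓ ^ 2 * ∑ q ∈ W', eucNorm (w q) := by
      rw [Finset.mul_sum]
      exact Finset.sum_le_sum fun q _ => mul_le_mul_of_nonneg_right (hghW q) (eucNorm_nonneg _)
    have h2 := sq_sum_le_card_mul_sum_sq (s := W') (f := fun q => eucNorm (w q))
    have hcard : (W'.card : ℝ) ≤ M := by rw [hM]; exact_mod_cast rig_card_window_le L K
    have h3 : (∑ q ∈ W', eucNorm (w q)) ^ 2 ≤ M * ∑ q ∈ W', eucNorm (w q) ^ 2 :=
      h2.trans (mul_le_mul_of_nonneg_right hcard (Finset.sum_nonneg fun _ _ => by positivity))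
    have h0 : 0 ≤ ∑ q ∈ W', f q := Finset.sum_nonneg fun q _ => hf0 q
    calc (∑ q ∈ W', f q) ^ 2 ≤ (2 * ℓ ^ 2 * ∑ q ∈ W', eucNorm (w q)) ^ 2 := pow_le_pow_left₀ h0 h1 2
      _ = 4 * ℓ ^ 4 * (∑ q ∈ W', eucNorm (w q)) ^ 2 := by ring
      _ ≤ 4 * ℓ ^ 4 * (M * ∑ q ∈ W', eucNorm (w q) ^ 2) := mul_le_mul_of_nonneg_left h3 (by positivity)
      _ = 4 * ℓ ^ 4 * M * ∑ q ∈ W', eucNorm (w q) ^ 2 := by ring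
  have hAT : (∑ q ∈ T, f q) ^ 2 ≤ (4 * (L : ℝ) ^ 3 * ℓ / K) * ((L : ℝ) ^ 2 * ((L : ℝ) ^ 2 * p₀ ^ 2)) := by
    have h1 := Finset.sum_mul_sq_le_sq_mul_sq T (fun q => ‖gh q‖) (fun q => eucNorm (w q))
    have h2 : ∑ q ∈ T, eucNorm (w q) ^ 2 ≤ (L : ℝ) ^ 2 * ((L : ℝ) ^ 2 * p₀ ^ 2) :=
      (Finset.sum_le_sum_of_subset_of_nonneg (Finset.filter_subset _ _) (fun q _ _ => by positivity)).trans hwsum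
    calc (∑ q ∈ T, f q) ^ 2 = (∑ q ∈ T, ‖gh q‖ * eucNorm (w q)) ^ 2 := by rw [hf]
      _ ≤ (∑ q ∈ T, ‖gh q‖ ^ 2) * ∑ q ∈ T, eucNorm (w q) ^ 2 := h1
      _ ≤ (4 * (L : ℝ) ^ 3 * ℓ / K) * ((L : ℝ) ^ 2 * ((L : ℝ) ^ 2 * p₀ ^ 2)) :=
          mul_le_mul hghT h2 (Finset.sum_nonneg fun _ _ => by positivity) (by positivity)
  -- combine
  have hsum0 : 0 ≤ ∑ q, f q := Finset.sum_nonneg fun q _ => hf0 q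
  have hE : eucNorm ((cellPair L k b - cellPair L k b') *ᵥ φ) ^ 2 ≤ ((L : ℝ) ^ 2)⁻¹ ^ 2 * (∑ q, f q) ^ 2 := by
    rw [← mul_pow]; exact pow_le_pow_left₀ (eucNorm_nonneg _) hnormG 2
  have h3 : (f 0 + ∑ q ∈ W', f q + ∑ q ∈ T, f q) ^ 2 ≤ 3 * ((f 0) ^ 2 + (∑ q ∈ W', f q) ^ 2 + (∑ q ∈ T, f q) ^ 2) := by
    nlinarith [sq_nonneg (f 0 - ∑ q ∈ W', f q), sq_nonneg ((∑ q ∈ W', f q) - ∑ q ∈ T, f q),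
      sq_nonneg (f 0 - ∑ q ∈ T, f q)]
  rw [← hsplit] at h3
  have hA0sq : f 0 ^ 2 ≤ (2 * ℓ * ((L : ℝ) ^ 2 * p₀)) ^ 2 := pow_le_pow_left₀ (hf0 0) hA0 2
  have hL4 : (0 : ℝ) < (L : ℝ) ^ 4 := by positivity
  have key : ((L : ℝ) ^ 2)⁻¹ ^ 2 * (∑ q, f q) ^ 2 ≤
      12 * (ℓ ^ 2 * p₀ ^ 2 + ℓ ^ 4 * M * ((∑ q ∈ W', eucNorm (w q) ^ 2) / (L : ℝ) ^ 4) + (L : ℝ) ^ 3 * ℓ * p₀ ^ 2 / K) := by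
    have hinv : ((L : ℝ) ^ 2)⁻¹ ^ 2 = 1 / (L : ℝ) ^ 4 := by field_simp
    rw [hinv, one_div, inv_mul_le_iff₀ hL4]
    have hB : (∑ q, f q) ^ 2 ≤ 3 * ((2 * ℓ * ((L : ℝ) ^ 2 * p₀)) ^ 2 + 4 * ℓ ^ 4 * M * ∑ q ∈ W', eucNorm (w q) ^ 2 +
        (4 * (L : ℝ) ^ 3 * ℓ / K) * ((L : ℝ) ^ 2 * ((L : ℝ) ^ 2 * p₀ ^ 2))) := by linarith
    refine hB.trans (le_of_eq ?_)
    field_simp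
    ring
  exact hE.trans key

/-- **One cell bond in Fourier variables, registered form** (all binders after the colon): the
statement of `rigc_bond_sq_le`. [folklore] -/
theorem rigc_bond_estimate : ∀ (L : ℕ) [NeZero L] (k : ℕ) [NeZero k] (K : ℕ), 1 ≤ K → ∀ (b : TorusSite 2 k) (i : Fin 2) (φ : Fock (Orb (FermionTorus 2 L))), star φ ⬝ᵥ φ = 1 → eucNorm ((cellPair L k b - cellPair L k (b + Pi.single i 1)) *ᵥ φ) ^ 2 ≤ 12 * (((L : ℝ) / k + 1) ^ 2 * (2 * ∑ e ∈ insert (0 : Site 2) unitSteps, |dWaveFormFactor e / Real.sqrt 2|) ^ 2 + ((L : ℝ) / k + 1) ^ 4 * (((2 * K + 1) ^ 2 : ℕ) : ℝ) * ((∑ q ∈ Finset.univ.filter (fun q : TorusSite 2 L => q ≠ 0 ∧ ∀ j : Fin 2, min (q j).val (L - (q j).val) ≤ K), eucNorm (∑ y : TorusSite 2 L, conj (torusChar q y) • (localPair dWaveFormFactor L y *ᵥ φ)) ^ 2) / (L : ℝ) ^ 4) + (L : ℝ) ^ 3 * ((L : ℝ) / k + 1) * (2 * ∑ e ∈ insert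 (0 : Site 2) unitSteps, |dWaveFormFactor e / Real.sqrt 2|) ^ 2 / K) :=
  fun L _ k _ _ hK b i _ hφ => rigc_bond_sq_le L k hK b i hφ

end Summit.HubbardSuperconductivity.HubbardSuperconductivity.Theorems.LowEnergyRigidity.Telescope
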